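import Summits.QuantumFields.BalabanUV.Beta.D1BFx.RestKernelGhostWords
import Summits.QuantumFields.BalabanUV.Beta.D1BFx.RestKernelSandwichSlot

/-!
# `BalabanUV.Beta.D1BFx.RestKernelGhostSlotJ` — road «BF-x» for binder row D1, slot (K): **«GHOST SLOT PACK J» — THE TWELVE GHOST REST WORDS AS ONE
# MEMBER FAMILY `RkGhJ ω a 𝒱 𝒲 : GhIdx → ℕ → …` OF THE (K) SLOT, GENERIC IN THE PER-SCALE GHOST JETS, WITH ITS POINTWISE SUM (= PART 10's
# `Σ_i ghostWordK (Ggh n a) (Pgt n a) 𝒱gh 𝒲gh i` AT `ω := 1`, junction J51), ITS `hMR` ROW FROM JET LETTERS, AND ITS `hRu` ∕ `hU` ROWS FROM DISPLAYED PER-WORD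
# (5.10) LETTERS** (OFFER O-d1leaf01-g23-1 → OWNER d1-p2 g19 «GO» in INTENT I-d1p2-g19-1: «PART 11 … `Rk := Sum.elim (RkSand …) (… (RkGhJ 1 a 𝒱gh 𝒲gh))`»).
# The twin of «RK-GH-WIRE» `RkGh` (p316918: the same words PINNED to the `wH`-packed jets) with the jets FREE — at the assembly
# `𝒱 n := n² • (x y a b ↦ Σ_κ wsum (colH G₀ n κ′ v κ) (ghCur κ) x y a b)`, `𝒲 n := n² • (… colH G₀ n … gh₂ …)` (PART 7∕8∕10's `colH G₀`-packed ghost jets).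

HONEST DEPENDENCY (cell records, verbatim): «continuum YM on T⁴ ⇐ BetaPertH ∧ nine spine estimates (0/9 proved); BetaPertH ⇐ (D1) ∧ (D4) ∧
CAP+tail; G-an2-4 gates asym, D1 and NE2/3/4.»  HONEST FRAMING (cell contract, verbatim): «discharging `BetaPertH` makes Bałaban's UV stability
UNCONDITIONAL — a real constructive-QFT result; it is NOT the continuum limit and NOT the Clay problem.»  THIS MODULE DISCHARGES NOTHING of the
wall: [folklore] pattern-matching ∕ `Finset.mul_sum` bookkeeping + the (1.22) read-out (`absMoment₂_of_decay510`, `secondMoment_abs_le_of_decay510`) BY NAME,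
plus two [our object] DATA definitions (`RkGhJ`, `CUghJ`; asserting nothing).  The per-word (5.10) letters `hdec : Decay510 (ghostWordK (Ggh n a) (Pgt n a) (𝒱 n) (𝒲 n) i μ ν) (K i) κ`
with n-FREE `K i`, `κ` are HYPOTHESES (displayed) — their discharge in the COLUMN currency (gan24-leaf-05 g53's located count: `colH G₀` envelope `n⁻⁴`) is «RK-GH UNIT J»
(leaf-04's lane by authorship of `RestKernelGhostUnit`; not here); the `hMR` row alone is also given from plain jet letters (`VertexFamily` ∕ `VertexFamily₂` at any rate).
No `def … : Prop`, no notation, nothing cited, 0 sorry.  0 root-level binders of row D1 discharged (hW ∕ hR-sockets ∕ hSX-socket ∕ D1Tel ∕ D1Rep — 0); (K) NOT closed;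
NOT D1, NOT `BetaPertH`, NOT continuum, NOT Clay.

ABSOLUTE RULE (cell charter, verbatim): «No internally-minted statement may enter as a cited fact. Every hypothesis is either kernel-proved in
this package or a verbatim quotation of a PUBLISHED theorem with page reference. The manuscript(s) under audit are NOT citable for their own
disputed steps — they are the thing under adjudication; programme-internal (2001/route/tribunal) claims are never citable.»

THE SHAPES (the (K1) END `RoadEndBFxDictPointwiseS.hdict_of_pointwise` at `υ := GhIdx`, `Rk := RkGhJ ω a 𝒱 𝒲`): `hMR`; `hRu`; `hU₁`; `hU` (as in the sibling slot packs).

CONTENT.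
* §1 [our object] **`RkGhJ ω a 𝒱 𝒲 i n μ ν z`** (`| 0 => 0`, `| m+1 => ω (m+1) · ghostWordK (Ggh (m+1) a) (Pgt (m+1) a) (𝒱 (m+1)) (𝒲 (m+1)) i μ ν z`); `RkGhJ_zero` ∕ `RkGhJ_succ` (`rfl`).
* §2 [folklore] **`sum_RkGhJ_succ`** (`= ω (m+1) · Σ_i ghostWordK …`, `Finset.mul_sum`), `sum_RkGhJ_succ_one` (`ω := fun _ => 1`: PART 10's ghost bracket VERBATIM at the jets),
  the scale-`n` junction forms `sum_RkGhJ_of_neZero` ∕ `sum_RkGhJ_one_of_neZero` (`n ≥ 1`, the shape PART 10 prints at `n := Lc^m`), `sum_RkGhJ_zero`.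
* §3 [folklore] **`hMR_RkGhJ`** from per-scale jet letters `VertexFamily (𝒱 (m+1)) (m+1) (Cv (m+1)) (δv (m+1))`, `VertexFamily₂ (𝒲 (m+1)) …` at any positive rates
  (my `RestKernelGhostWords.absMoment₂_ghostWordK_road'`).
* §4 [our object] **`CUghJ Ω K κ i := Ω·K i·Σ'_x |x|₁²·e^{−κ|x|₁}`**; `CUghJ_nonneg`; `sum_CUghJ` (the `hU₁` fragment); [folklore] `decay510_const_mul`; **`rows_RkGhJ (hω : |ω n| ≤ Ω) (hκ) (hK)
  (hdec : ∀ m i, Decay510 (ghostWordK … (m+1) … i μ ν) (K i) κ)`** (every `n ≥ 1`: `AbsMoment₂` ∧ `|secondMoment| ≤ CUghJ Ω K κ i`); **`END_rows_RkGhJ`** (the END's shapes at `n = Lc^m`).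
NOT HERE (honest): the per-word letters `K i`, `κ` at the `colH G₀` jets («RK-GH UNIT J»); ΔGH (its own member, `RestKernelDeltaGHWiring`); `hptw`; any statement about `TshotOf`.
Unit `b2b-balaban-beta-d1-formalise-leaf-01` (gen 23), D1 formalisation swarm leaf prover 01, road «BF-x»; OFFER O-1 → OWNER GO (journal).
-/

noncomputable section

open Finset
open scoped BigOperators
open Literature.MathematicalPhysics.QuantumFieldTheory.Balaban1983to89
open Literature.MathematicalPhysics.QuantumFieldTheory.Balaban1983to89.Beta
open B12Sec2to5 (l1 l1_nonneg Decay510 secondMoment_abs_le_of_decay510)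
open DecimatedMomentSummable (AbsMoment₂ absMoment₂_of_decay510)
open ExpKernelCalculus (Site MKer VertexFamily VertexFamily₂)
open Summit.QuantumFields.BalabanUV.Beta.D1BFx.RProjector (Pgt)
open Summit.QuantumFields.BalabanUV.Beta.D1BFx.GhostLeg (Ggh)
open Summit.QuantumFields.BalabanUV.Beta.D1BFx.RestKernelGhostWords (GhIdx ghostWordK absMoment₂_ghostWordK_road')
open Summit.QuantumFields.BalabanUV.Beta.D1BFx.RestKernelSandwichSlot (tsum_moment_nonneg)

namespace Summit.QuantumFields.BalabanUV.Beta.D1BFx.RestKernelGhostSlotJ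

/-! ## §1 The twelve ghost members, generic in the jets, TOTAL in the block size -/

/-- [our object] **THE GHOST FRAGMENT OF THE (K) SLOT, GENERIC IN THE JETS**: `RkGhJ ω a 𝒱 𝒲 i n μ ν z` := `ω n ·` the ghost rest word
`ghostWordK (Ggh n a) (Pgt n a) (𝒱 n) (𝒲 n) i μ ν z` at `n = m + 1` (per-scale ghost jets `𝒱 n`, `𝒲 n` — the assembly's; `ω` a displayed scalar weight family,
`ω := 1` in PART 11) and `0` at the junk block size `n = 0` (pattern matching; `Ggh n a` carries `[NeZero n]`).  A DEFINITION; asserts nothing. -/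
def RkGhJ (ω : ℕ → ℝ) (a : ℝ) (𝒱 : ℕ → Fin 4 → Site 4 → MKer 4 Unit) (𝒲 : ℕ → Fin 4 → Site 4 → Fin 4 → Site 4 → MKer 4 Unit) (i : GhIdx) :
    ℕ → Fin 4 → Fin 4 → Site 4 → ℝ
  | 0 => fun _ _ _ => 0
  | m + 1 => fun μ ν z => ω (m + 1) * ghostWordK (Ggh (m + 1) a) (Pgt (m + 1) a) (𝒱 (m + 1)) (𝒲 (m + 1)) i μ ν z

variable (ω : ℕ → ℝ) (a : ℝ) (𝒱 : ℕ → Fin 4 → Site 4 → MKer 4 Unit) (𝒲 : ℕ → Fin 4 → Site 4 → Fin 4 → Site 4 → MKer 4 Unit)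

/-- [our object] The junk value: at `n = 0` every member is the zero kernel. -/
theorem RkGhJ_zero (i : GhIdx) : RkGhJ ω a 𝒱 𝒲 i 0 = fun _ _ _ => 0 := rfl

/-- [our object] **AT `n = m + 1` THE MEMBER IS THE WEIGHTED GHOST WORD AT THE JETS `𝒱 (m+1)`, `𝒲 (m+1)`** (`rfl`). -/
theorem RkGhJ_succ (i : GhIdx) (m : ℕ) :
    RkGhJ ω a 𝒱 𝒲 i (m + 1) = fun μ ν z => ω (m + 1) * ghostWordK (Ggh (m + 1) a) (Pgt (m + 1) a) (𝒱 (m + 1)) (𝒲 (m + 1)) i μ ν z := rfl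

/-! ## §2 The pointwise sum: PART 10's ghost bracket -/

/-- [folklore] **THE GHOST LANE's CONTRIBUTION TO `Σ_u Rk u (m+1) μ ν z`**: `ω (m+1) · Σ_i ghostWordK (Ggh (m+1) a) (Pgt (m+1) a) (𝒱 (m+1)) (𝒲 (m+1)) i μ ν z`. -/
theorem sum_RkGhJ_succ (m : ℕ) (μ ν : Fin 4) (z : Site 4) :
    ∑ i : GhIdx, RkGhJ ω a 𝒱 𝒲 i (m + 1) μ ν z
      = ω (m + 1) * ∑ i : GhIdx, ghostWordK (Ggh (m + 1) a) (Pgt (m + 1) a) (𝒱 (m + 1)) (𝒲 (m + 1)) i μ ν z := by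
  rw [Finset.mul_sum]
  rfl

/-- [folklore] **AT THE UNIT WEIGHT `ω := 1` THE SUM IS PART 10's GHOST BRACKET VERBATIM** — `Σ_i ghostWordK (Ggh (m+1) a) (Pgt (m+1) a) (𝒱 (m+1)) (𝒲 (m+1)) i μ ν z`
(= PART 7∕8's `R₁₆` at the `colH G₀` ghost jets, junction J51 `RestKernelGhostWords.pRemK_sixteen_eq_sum_ghostWordK`). -/
theorem sum_RkGhJ_succ_one (m : ℕ) (μ ν : Fin 4) (z : Site 4) :
    ∑ i : GhIdx, RkGhJ (fun _ => (1 : ℝ)) a 𝒱 𝒲 i (m + 1) μ ν z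
      = ∑ i : GhIdx, ghostWordK (Ggh (m + 1) a) (Pgt (m + 1) a) (𝒱 (m + 1)) (𝒲 (m + 1)) i μ ν z := by
  rw [sum_RkGhJ_succ, one_mul]

/-- [folklore] **THE GHOST LANE's SUM AT ANY SCALE `n ≥ 1`**: `ω n · Σ_i ghostWordK (Ggh n a) (Pgt n a) (𝒱 n) (𝒲 n) i μ ν z` (`sum_RkGhJ_succ` at `n = k + 1`;
the `[NeZero n]` instance inside `Ggh` is a proof of a `Prop`, so the two spellings agree by `rfl`). -/
theorem sum_RkGhJ_of_neZero (n : ℕ) [NeZero n] (μ ν : Fin 4) (z : Site 4) :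
    ∑ i : GhIdx, RkGhJ ω a 𝒱 𝒲 i n μ ν z = ω n * ∑ i : GhIdx, ghostWordK (Ggh n a) (Pgt n a) (𝒱 n) (𝒲 n) i μ ν z := by
  obtain ⟨k, rfl⟩ := Nat.exists_eq_succ_of_ne_zero (NeZero.ne n)
  rw [sum_RkGhJ_succ]

/-- [folklore] **AT `ω := 1` AND ANY SCALE `n ≥ 1` THE SUM IS PART 10's GHOST BRACKET IN THE SHAPE IT PRINTS** (`PackedRoadHptwScales.hptw_of_junctions` at
`n := Lc^m`: `Σ_{i : GhIdx} ghostWordK (Ggh n a) (Pgt n a) (𝒱gh n) (𝒲gh n) i μ ν z` at the `colH G₀`-packed ghost jets). -/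
theorem sum_RkGhJ_one_of_neZero (n : ℕ) [NeZero n] (μ ν : Fin 4) (z : Site 4) :
    ∑ i : GhIdx, RkGhJ (fun _ => (1 : ℝ)) a 𝒱 𝒲 i n μ ν z = ∑ i : GhIdx, ghostWordK (Ggh n a) (Pgt n a) (𝒱 n) (𝒲 n) i μ ν z := by
  rw [sum_RkGhJ_of_neZero, one_mul]

/-- [folklore] … and at the junk block size it is `0`. -/
theorem sum_RkGhJ_zero (μ ν : Fin 4) (z : Site 4) : ∑ i : GhIdx, RkGhJ ω a 𝒱 𝒲 i 0 μ ν z = 0 :=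
  Finset.sum_eq_zero fun _ _ => rfl

/-! ## §3 The `hMR` row from plain jet letters -/

section MR

variable {ω a 𝒱 𝒲} (ha : 0 < a) {Cv Cw δv : ℕ → ℝ} {μ ν : Fin 4}
include ha

/-- [folklore] Every member has an absolutely summable second moment at `n = m + 1` once the jets are localised at the coarse bonds at ANY positive rate
(`absMoment₂_ghostWordK_road'`; `AbsMoment₂` is stable under the scalar `ω (m+1)`). -/
theorem absMoment₂_RkGhJ_succ (hV : ∀ m, VertexFamily (𝒱 (m + 1)) (m + 1) (Cv (m + 1)) (δv (m + 1)))
    (hW : ∀ m, VertexFamily₂ (𝒲 (m + 1)) (m + 1) (Cw (m + 1)) (δv (m + 1))) (hδv : ∀ m, 0 < δv (m + 1)) (i : GhIdx) (m : ℕ) :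
    AbsMoment₂ (RkGhJ ω a 𝒱 𝒲 i (m + 1) μ ν) := by
  rw [RkGhJ_succ]
  exact HessianTelescopingKKT.absMoment₂_const_mul'
    (absMoment₂_ghostWordK_road' (m + 1) ha (hV m) (hW m) (hδv m) (Nat.le_add_left 1 m) i μ ν) _

/-- [folklore] **THE END's `hMR` ROW FOR THE GHOST LANE FROM JET LETTERS** (any `[NeZero Lc]`). -/
theorem hMR_RkGhJ {Lc : ℕ} [NeZero Lc] (hV : ∀ m, VertexFamily (𝒱 (m + 1)) (m + 1) (Cv (m + 1)) (δv (m + 1)))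
    (hW : ∀ m, VertexFamily₂ (𝒲 (m + 1)) (m + 1) (Cw (m + 1)) (δv (m + 1))) (hδv : ∀ m, 0 < δv (m + 1)) :
    ∀ (i : GhIdx) (m : ℕ), 1 ≤ m → AbsMoment₂ (RkGhJ ω a 𝒱 𝒲 i (Lc ^ m) μ ν) := by
  intro i m _
  obtain ⟨k, hk⟩ : ∃ k, Lc ^ m = k + 1 := ⟨Lc ^ m - 1, (Nat.sub_add_cancel (Nat.one_le_pow _ _ (Nat.pos_of_ne_zero (NeZero.ne Lc)))).symm⟩
  rw [hk]
  exact absMoment₂_RkGhJ_succ ha hV hW hδv i k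

end MR

/-! ## §4 The read-out rows from displayed per-word (5.10) letters -/

/-- [our object] **THE n-FREE READ-OUT CONSTANT PER MEMBER**: `Ω·K i·Σ'_x |x|₁²·e^{−κ|x|₁}` (weight bound `Ω`, per-word (5.10) constant `K i`, rate `κ`).
A DEFINITION of a real number per member; asserts nothing. -/
def CUghJ (Ω : ℝ) (K : GhIdx → ℝ) (κ : ℝ) : GhIdx → ℝ := fun i => Ω * K i * ∑' x : Site 4, l1 x ^ 2 * Real.exp (-κ * l1 x)

/-- [our object] Unfolding `CUghJ`. -/
theorem CUghJ_apply (Ω : ℝ) (K : GhIdx → ℝ) (κ : ℝ) (i : GhIdx) : CUghJ Ω K κ i = Ω * K i * ∑' x : Site 4, l1 x ^ 2 * Real.exp (-κ * l1 x) := rfl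

/-- [folklore] The read-out constants are nonnegative (`0 ≤ Ω`, `0 ≤ K i`). -/
theorem CUghJ_nonneg {Ω : ℝ} {K : GhIdx → ℝ} (hΩ : 0 ≤ Ω) (hK : ∀ i, 0 ≤ K i) (κ : ℝ) (i : GhIdx) : 0 ≤ CUghJ Ω K κ i := by
  rw [CUghJ_apply]
  exact mul_nonneg (mul_nonneg hΩ (hK i)) (tsum_moment_nonneg _)

/-- [folklore] **THE LANE's `hU₁` FRAGMENT**: `Σ_i CUghJ Ω K κ i = Ω·(Σ_i K i)·Σ'_x |x|₁²·e^{−κ|x|₁}` — n-free. -/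
theorem sum_CUghJ (Ω : ℝ) (K : GhIdx → ℝ) (κ : ℝ) :
    ∑ i : GhIdx, CUghJ Ω K κ i = Ω * (∑ i : GhIdx, K i) * ∑' x : Site 4, l1 x ^ 2 * Real.exp (-κ * l1 x) := by
  simp only [CUghJ_apply, Finset.mul_sum, Finset.sum_mul]

/-- [folklore] (5.10) decay is stable under a scalar: `Decay510 f C δ ⟹ Decay510 (c·f) (|c|·C) δ`. -/
theorem decay510_const_mul {f : Site 4 → ℝ} {C δ : ℝ} (h : Decay510 f C δ) (c : ℝ) : Decay510 (fun z => c * f z) (|c| * C) δ := by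
  intro z
  rw [abs_mul, mul_assoc]
  exact mul_le_mul_of_nonneg_left (h z) (abs_nonneg c)

section Rows

variable {ω a 𝒱 𝒲} {Ω κ : ℝ} {K : GhIdx → ℝ} {μ ν : Fin 4}

/-- [folklore] **THE ROWS OF THE GHOST LANE, EVERY BLOCK SIZE `n ≥ 1`**, on the displayed weight bound `|ω n| ≤ Ω` and the DISPLAYED per-word (5.10) letters
`Decay510 (ghostWordK (Ggh (m+1) a) (Pgt (m+1) a) (𝒱 (m+1)) (𝒲 (m+1)) i μ ν) (K i) κ` (n-free `K i ≥ 0`, `κ > 0`): every member has an absolutely summable second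
moment and `|secondMoment (RkGhJ ω a 𝒱 𝒲 i n) μ ν| ≤ CUghJ Ω K κ i`. -/
theorem rows_RkGhJ (hω : ∀ n, |ω n| ≤ Ω) (hκ : 0 < κ) (hK : ∀ i, 0 ≤ K i)
    (hdec : ∀ (m : ℕ) (i : GhIdx), Decay510 (ghostWordK (Ggh (m + 1) a) (Pgt (m + 1) a) (𝒱 (m + 1)) (𝒲 (m + 1)) i μ ν) (K i) κ) :
    ∀ (i : GhIdx) (n : ℕ), 1 ≤ n → AbsMoment₂ (RkGhJ ω a 𝒱 𝒲 i n μ ν) ∧ |B12Beta.secondMoment (RkGhJ ω a 𝒱 𝒲 i n) μ ν| ≤ CUghJ Ω K κ i := by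
  intro i n hn
  obtain ⟨m, rfl⟩ : ∃ m, n = m + 1 := ⟨n - 1, (Nat.sub_add_cancel hn).symm⟩
  have hd : Decay510 (RkGhJ ω a 𝒱 𝒲 i (m + 1) μ ν) (Ω * K i) κ := by
    rw [RkGhJ_succ]
    exact ExpKernelCalculus.decay510_mono_const (decay510_const_mul (hdec m i) (ω (m + 1)))
      (mul_le_mul_of_nonneg_right (hω (m + 1)) (hK i))
  refine ⟨absMoment₂_of_decay510 hκ hd, ?_⟩
  rw [CUghJ_apply]
  exact (secondMoment_abs_le_of_decay510 (P := RkGhJ ω a 𝒱 𝒲 i (m + 1)) hκ hd).2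

/-- [folklore] **THE GHOST LANE's ROWS IN THE END's SHAPES** (`RoadEndBFxDictPointwiseS.hdict_of_pointwise` at `υ := GhIdx`, `Rk := RkGhJ ω a 𝒱 𝒲`, any `[NeZero Lc]`):
(i) `hMR`; (ii) READING (b): `hRu` with `Ru := 0`, `CU′ := CUghJ Ω K κ`; (iii) READING (a): `hRu` with `CU′ := 0` and `hU` with `CU := CUghJ Ω K κ` at every `n ≥ 2`;
(iv) the unit row at every `n ≥ 1`.  The `hU₁` fragment is `sum_CUghJ`. -/
theorem END_rows_RkGhJ {Lc : ℕ} [NeZero Lc] (hω : ∀ n, |ω n| ≤ Ω) (hκ : 0 < κ) (hK : ∀ i, 0 ≤ K i)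
    (hdec : ∀ (m : ℕ) (i : GhIdx), Decay510 (ghostWordK (Ggh (m + 1) a) (Pgt (m + 1) a) (𝒱 (m + 1)) (𝒲 (m + 1)) i μ ν) (K i) κ) :
    -- (i) `hMR`
    (∀ (i : GhIdx) (m : ℕ), 1 ≤ m → AbsMoment₂ (RkGhJ ω a 𝒱 𝒲 i (Lc ^ m) μ ν)) ∧
    -- (ii) READING (b)
    (∀ (i : GhIdx) (m : ℕ), 1 ≤ m →
      |B12Beta.secondMoment (RkGhJ ω a 𝒱 𝒲 i (Lc ^ m)) μ ν - (fun (_ : GhIdx) (_ : ℕ) => (0 : ℝ)) i (Lc ^ m)| ≤ CUghJ Ω K κ i) ∧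
    -- (iii) READING (a)
    (∀ (i : GhIdx) (m : ℕ), 1 ≤ m →
      |B12Beta.secondMoment (RkGhJ ω a 𝒱 𝒲 i (Lc ^ m)) μ ν - (fun (i : GhIdx) (n : ℕ) => B12Beta.secondMoment (RkGhJ ω a 𝒱 𝒲 i n) μ ν) i (Lc ^ m)|
        ≤ (fun _ : GhIdx => (0 : ℝ)) i) ∧
    (∀ n : ℕ, 2 ≤ n → ∀ i : GhIdx, |(fun (i : GhIdx) (n : ℕ) => B12Beta.secondMoment (RkGhJ ω a 𝒱 𝒲 i n) μ ν) i n| ≤ CUghJ Ω K κ i) ∧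
    -- (iv) the n-uniform unit row
    (∀ (i : GhIdx) (n : ℕ), 1 ≤ n → |B12Beta.secondMoment (RkGhJ ω a 𝒱 𝒲 i n) μ ν| ≤ CUghJ Ω K κ i) := by
  have hrows := rows_RkGhJ (μ := μ) (ν := ν) hω hκ hK hdec
  have hLm : ∀ m : ℕ, 1 ≤ Lc ^ m := fun m => Nat.one_le_pow _ _ (Nat.pos_of_ne_zero (NeZero.ne Lc))
  refine ⟨fun i m _ => (hrows i (Lc ^ m) (hLm m)).1, fun i m _ => ?_, fun i m _ => ?_, fun n hn i => ?_, fun i n hn => (hrows i n hn).2⟩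
  · rw [sub_zero]
    exact (hrows i (Lc ^ m) (hLm m)).2
  · rw [sub_self, abs_zero]
  · exact (hrows i n ((Nat.le_succ 1).trans hn)).2

end Rows

end Summit.QuantumFields.BalabanUV.Beta.D1BFx.RestKernelGhostSlotJ

end
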